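import Summits.AtomisticToContinuum.Crystallization.Theses.ChessboardParticlePlanes
import Summits.AtomisticToContinuum.Crystallization.Theses.HullMinimality
import Summits.AtomisticToContinuum.Crystallization.Theorems.PhononSlackCertificatesPeriodicGivenLayered

/-!
# Crux `PeriodicWindows` (stmt-AtomisticToContinuum-3240) — glue of the strategist's split D2

The crux-strategist s1 (`Cruxes/PeriodicWindows/STRATEGY-CENSUS.md`, §Decomposition, D2) cut the crux into

* C1 `OneLaminarWindow` — one `η`-laminar particle-centred closed `L`-window at every scale, frequently in `N`,
  along every Lennard-Jones ground-state sequence (≡ item stmt-6711 `LjLaminarWindows` up to the landed iff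
  `LjLaminarWindowsSketch.LjLaminarWindows_iff_oneWindowAllScales`; the layering wall W1), and
* C2 `LayeredOfLaminarWindows` — C1 implies the layered windows of route `HullMinimality`
  (`HullMinimality.LayeredWindows`, item stmt-11778: one spacing `a ∈ [47/50, 1]`, free Hägg word, free gaps in
  `[39a/50, 17a/20]`, one window per scale frequently in `N`; the planar-order wall W2),

with glue `C1 → C2 → PeriodicWindows` = modus ponens followed by the LANDED stacking selection in the hull
`LayeredHull.PeriodicGivenLayered_of` (item stmt-11779). This file is that glue, kernel-checked, so that the tenure
planner's `route edit --split PeriodicWindows` can name it (`--glue-decl-name PeriodicWindowsOfLaminarLayered`); the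
strategist's own copy (evidence `ChessboardParticlePlanesPeriodicWindowsSplit.lean`, 2026-08-17T04:15Z) could not be
proposed from a planner seat (`perm.theorems-prover-only`). Also recorded: `PeriodicWindows_of_layeredWindows`, the
one-line bridge 11778 ⇒ 3240 by name.
-/

noncomputable section

namespace Summit.AtomisticToContinuum.Crystallization.Theorems.PeriodicWindowsSplit

open Literature.MathematicalPhysics.StatisticalMechanics Filter
open Summit.AtomisticToContinuum.Crystallization.Theses.ChessboardParticlePlanes (PeriodicWindows)
open Summit.AtomisticToContinuum.Crystallization.Theses.HullMinimality (LayeredWindows)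

/-- Bridge 11778 ⇒ 3240 by name: the layered windows of route `HullMinimality` (item stmt-11778) give the periodic
windows of the crux, by the landed `LayeredHull.PeriodicGivenLayered_of` (item stmt-11779) applied sequence by
sequence. [folklore] -/
theorem PeriodicWindows_of_layeredWindows (hlay : LayeredWindows) : PeriodicWindows := by
  intro x hx
  have hpgl := Summit.AtomisticToContinuum.Crystallization.Theorems.LayeredHull.PeriodicGivenLayered_of
  unfold Summit.AtomisticToContinuum.Crystallization.Theses.PhononSlackCertificates.PeriodicGivenLayered at hpgl
  exact hpgl x hx (hlay x hx)

/-- **Glue of the split D2** (`C1 → C2 → PeriodicWindows`): if along every Lennard-Jones ground-state sequence there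
is, for every `η > 0` and every radius `L`, frequently in `N`, one particle-centred closed `L`-window that is
`η`-laminar in a rotated third coordinate with `3/4`-separated levels (C1 `OneLaminarWindow`), and if C1 implies the
layered windows `HullMinimality.LayeredWindows` of item stmt-11778 (C2 `LayeredOfLaminarWindows`), then the crux
`PeriodicWindows` holds — modus ponens and `PeriodicWindows_of_layeredWindows`. [folklore] -/
theorem PeriodicWindows_of_oneLaminarWindow_of_layered : (∀ x : (N : ℕ) → (Fin N → EuclideanSpace ℝ (Fin 3)), (∀ N, IsGroundState lennardJones (x N)) → ∀ η : ℝ, 0 < η → ∀ L : ℝ, ∃ᶠ N in Filter.atTop, ∃ (i : Fin N) (A : EuclideanSpace ℝ (Fin 3) →ₗᵢ[ℝ] EuclideanSpace ℝ (Fin 3)) (T : Set ℝ), (∀ t ∈ T, ∀ t' ∈ T, t ≠ t' → (3 : ℝ) / 4 ≤ |t - t'|) ∧ (∀ j : Fin N, dist (x N j) (x N i) ≤ L → ∃ t ∈ T, |(A (x N j - x N i)) 2 - t| ≤ η)) → ((∀ x : (N : ℕ) → (Fin N → EuclideanSpace ℝ (Fin 3)), (∀ N, IsGroundState lennardJones (x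 N)) → ∀ η : ℝ, 0 < η → ∀ L : ℝ, ∃ᶠ N in Filter.atTop, ∃ (i : Fin N) (A : EuclideanSpace ℝ (Fin 3) →ₗᵢ[ℝ] EuclideanSpace ℝ (Fin 3)) (T : Set ℝ), (∀ t ∈ T, ∀ t' ∈ T, t ≠ t' → (3 : ℝ) / 4 ≤ |t - t'|) ∧ (∀ j : Fin N, dist (x N j) (x N i) ≤ L → ∃ t ∈ T, |(A (x N j - x N i)) 2 - t| ≤ η)) → LayeredWindows) → PeriodicWindows :=
  fun h₁ h₂ => PeriodicWindows_of_layeredWindows (h₂ h₁)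

end Summit.AtomisticToContinuum.Crystallization.Theorems.PeriodicWindowsSplit

end
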